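import Mathlib
import Literature.NumberTheory.Automorphic.HilbertModularFormQExpansion

/-!
# The dual lattice of `𝓞 F` is `ℤ^ι` in integral-basis coordinates

Stub `stub_dualLatticeEquiv` (L1) for line Sketch-ideate-r1-k1 of the crux
`HilbertIntegralOverconvergentIsCongruence` (stmt-Langlands-8485).  The Fourier expansion of an
`𝓞 F`-periodic holomorphic function on the tube domain is indexed by the dual lattice
`𝔡⁻¹ = {ν ∈ F : Tr(ν a) ∈ ℤ for all a ∈ 𝓞 F}`, while the torus expansion in integral-basis
coordinates is indexed by `ℤ^ι`, `ι = Module.Free.ChooseBasisIndex ℤ (𝓞 F)`.  This file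
identifies the two index sets by `ν ↦ (Tr(ν b_i))_i`, `b = NumberField.integralBasis F`.
Proof: every `a : 𝓞 F` is a `ℤ`-combination of the `b_i`, so `ν ∈ 𝔡⁻¹` iff all `Tr(ν b_i) ∈ ℤ`;
the inverse map is `n ↦ ∑ i, n_i b^∨_i` with `b^∨ = b.traceDual` the dual basis of `b` for the
(non-degenerate) trace form of `F/ℚ` (Mathlib `Module.Basis.traceDual`, `trace_traceDual_mul`,
`traceDual_repr_apply`).
-/

set_option linter.dupNamespace false

noncomputable section

namespace Summit.Langlands.Langlands.Theorems.HilbertIntegralOverconvergentIsCongruence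

open NumberField

/-- An algebraic integer `a : 𝓞 F`, viewed in `F`, is the `ℤ`-combination of the integral basis
`integralBasis F` with coefficients its coordinates in `RingOfIntegers.basis F`. -/
theorem dualLattice_coe_eq_sum_integralBasis (F : Type) [Field F] [NumberField F] (a : 𝓞 F) :
    (a : F) = ∑ i, (((RingOfIntegers.basis F).repr a i : ℤ) : ℚ) • integralBasis F i := by
  conv_lhs => rw [RingOfIntegers.coe_eq_algebraMap, ← (integralBasis F).sum_repr (algebraMap _ _ a)]
  simp only [integralBasis_repr_apply, eq_intCast]

/-- Membership in the dual lattice `{ν : Tr(ν a) ∈ ℤ ∀ a ∈ 𝓞 F}` is tested on the integral basis: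
if `Tr(ν b_i) ∈ ℤ` for every `i` then `Tr(ν a) ∈ ℤ` for every `a : 𝓞 F`. -/
theorem dualLattice_mem_of_integralBasis (F : Type) [Field F] [NumberField F] {ν : F}
    (h : ∀ i, ∃ n : ℤ, Algebra.trace ℚ F (ν * integralBasis F i) = n) (a : 𝓞 F) :
    ∃ n : ℤ, Algebra.trace ℚ F (ν * a) = n := by
  choose n hn using h
  refine ⟨∑ i, (RingOfIntegers.basis F).repr a i * n i, ?_⟩
  rw [dualLattice_coe_eq_sum_integralBasis F a, Finset.mul_sum, map_sum]
  push_cast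
  refine Finset.sum_congr rfl fun i _ ↦ ?_
  rw [mul_smul_comm, map_smul, hn, smul_eq_mul]

/-- Traces against the integral basis of a `ℚ`-combination of its trace-dual basis recover the
coefficients: `Tr((∑ i, n_i b^∨_i) b_j) = n_j`. -/
theorem dualLattice_trace_sum_traceDual_mul (F : Type) [Field F] [NumberField F]
    [DecidableEq (Module.Free.ChooseBasisIndex ℤ (𝓞 F))]
    (n : Module.Free.ChooseBasisIndex ℤ (𝓞 F) → ℚ) (j : Module.Free.ChooseBasisIndex ℤ (𝓞 F)) :
    Algebra.trace ℚ F ((∑ i, n i • (integralBasis F).traceDual i) * integralBasis F j) = n j := by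
  rw [Finset.sum_mul, map_sum]
  simp only [smul_mul_assoc, map_smul, Module.Basis.trace_traceDual_mul, smul_eq_mul, mul_ite,
    mul_one, mul_zero, Finset.sum_ite_eq, Finset.mem_univ, if_true]

/-- **stub L1 — `stub_dualLatticeEquiv`.** The dual lattice
`𝔡⁻¹ = {ν ∈ F : Tr(νa) ∈ ℤ ∀ a ∈ 𝓞 F}` of the translation lattice is identified with `ℤ^ι` by
`ν ↦ (Tr(ν b_i))_i`, `b` the integral basis: injective because the trace form of the separable
extension `F/ℚ` is non-degenerate and `b` is a `ℚ`-basis of `F` (Mathlib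
`Algebra.traceForm_nondegenerate`), surjective by the dual basis `b^∨` (`Module.Basis.traceDual`:
`ν = ∑_j n_j b^∨_j` has `Tr(ν b_i) = n_i` and lies in `𝔡⁻¹`). [folklore] -/
theorem stub_dualLatticeEquiv (F : Type) [Field F] [NumberField F] :
    ∃ e : {ν : F | ∀ a : 𝓞 F, ∃ n : ℤ, Algebra.trace ℚ F (ν * a) = n} ≃
        (Module.Free.ChooseBasisIndex ℤ (𝓞 F) → ℤ),
      ∀ (ν : {ν : F | ∀ a : 𝓞 F, ∃ n : ℤ, Algebra.trace ℚ F (ν * a) = n})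
        (i : Module.Free.ChooseBasisIndex ℤ (𝓞 F)),
        ((e ν i : ℤ) : ℚ) = Algebra.trace ℚ F ((ν : F) * integralBasis F i) := by
  classical
  set D := {ν : F | ∀ a : 𝓞 F, ∃ n : ℤ, Algebra.trace ℚ F (ν * a) = n} with hD
  -- forward coordinates `ν ↦ (Tr(ν b_i))_i ∈ ℤ^ι`
  have hcoord : ∀ (ν : D) (i : Module.Free.ChooseBasisIndex ℤ (𝓞 F)),
      ∃ n : ℤ, Algebra.trace ℚ F ((ν : F) * integralBasis F i) = n := fun ν i ↦ by
    rw [integralBasis_apply]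
    exact ν.2 _
  choose c hc using hcoord
  -- inverse `n ↦ ∑ i, n_i b^∨_i`
  have hg : ∀ n : Module.Free.ChooseBasisIndex ℤ (𝓞 F) → ℤ,
      (∑ i, ((n i : ℤ) : ℚ) • (integralBasis F).traceDual i) ∈ D := fun n ↦ by
    rw [hD, Set.mem_setOf_eq]
    exact dualLattice_mem_of_integralBasis F fun j ↦
      ⟨n j, dualLattice_trace_sum_traceDual_mul F (fun i ↦ ((n i : ℤ) : ℚ)) j⟩
  refine ⟨⟨c, fun n ↦ ⟨_, hg n⟩, fun ν ↦ ?_, fun n ↦ ?_⟩, fun ν i ↦ (hc ν i).symm⟩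
  · -- left inverse: `ν = ∑ i, Tr(ν b_i) b^∨_i`
    apply Subtype.ext
    change ∑ i, ((c ν i : ℤ) : ℚ) • (integralBasis F).traceDual i = (ν : F)
    conv_rhs => rw [← ((integralBasis F).traceDual).sum_repr (ν : F)]
    refine Finset.sum_congr rfl fun i _ ↦ ?_
    rw [Module.Basis.traceDual_repr_apply, Algebra.traceForm_apply, hc]
  · -- right inverse: `Tr((∑ i, n_i b^∨_i) b_j) = n_j`
    funext j
    apply Int.cast_injective (α := ℚ)
    rw [← hc]
    exact dualLattice_trace_sum_traceDual_mul F (fun i ↦ ((n i : ℤ) : ℚ)) j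

end Summit.Langlands.Langlands.Theorems.HilbertIntegralOverconvergentIsCongruence

end
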